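import Literature.AlgebraicGeometry.Resolution.EmbeddedResolutionExcellentSurfacesResolution
import Literature.AlgebraicGeometry.Resolution.StrictNormalCrossingsGeneralization
import Literature.AlgebraicGeometry.Resolution.BlowupsFlatBaseChange
import HarnessLib

/-!
# Resolution of integral surfaces of codimension `≥ 2` in a regular excellent scheme, from CJS Thm. 1.4 (`B = ∅`)

Topic: `Literature/AlgebraicGeometry/Resolution` (proofs only: no new notions, no new named facts).

Sequel of `EmbeddedResolutionExcellentSurfacesResolution.lean`.  The vendored form of Cossart–Jannsen–Saito 2020,
Thm. 1.4 with `B = ∅` (`CossartJannsenSaito2020Embedded`) allows degenerate data (a centre swallowing the strict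
transform, after which the iterated strict transform `X₁` is empty); the previous file turned every
NON-degenerate datum into a resolution of singularities of the embedded integral scheme `X`.  Here the degenerate
case is excluded when `X` has codimension `≥ 2` in `Z` at its generic point:

* `CossartJannsenSaito2020Embedded.hasResolution_of_two_le_ringKrullDim` — for a closed immersion `i : X ↪ Z` of
  an integral scheme of dimension `≤ 2` into a Noetherian regular excellent scheme with
  `dim 𝒪_{Z, i(η_X)} ≥ 2`, `X` admits a resolution of singularities (`Scheme.HasResolution X`).

Why the codimension hypothesis kills the degenerate case: if `X₁ = ∅` then `π⁻¹(i(X)) = B₁` is a normal crossings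
divisor containing the point `ξ₁` over `ξ = i(η_X)`; `π` is an isomorphism over an open `U ∋ ξ` (it is one off
`i(X_sing)`), so `𝒪_{Z₁,ξ₁} ≅ 𝒪_{Z,ξ}` has dimension `≥ 2`, and then `B₁` contains a proper generalization `η` of
`ξ₁` (`IsStrictNormalCrossingsDivisor.exists_specializes_ne_of_two_le_ringKrullDim`); but `π(η)` generalizes `ξ`
inside `i(X)`, so `π(η) = ξ`, contradicting the uniqueness of the point over `ξ ∈ U`.

Purpose (Cossart–Piltant 2019 bookkeeping, crux `CleanModels`): serve the non-embedded uses of resolution of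
excellent surfaces in CP 2019's architecture from the embedded theorem (the crux's stub 1) alone; the consumers
arrange codimension `≥ 2` by adding two polynomial variables to the ambient regular scheme.

## Sources

* V. Cossart, U. Jannsen, S. Saito, *Desingularization: Invariants and Strategy*, LNM 2270 (2020), Thm. 1.4 and
  p. 7 (proof of Cor. 1.5). [CossartJannsenSaito2020]
* E. Bierstone, D. Grigoriev, P. Milman, J. Włodarczyk, Asian J. Math. 15 (2011), §3.3 (3)⇒(4).
  [BierstoneGrigorievMilmanWlodarczyk2011]
-/

noncomputable section

open CategoryTheory CategoryTheory.Limits AlgebraicGeometry TopologicalSpace Topology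

namespace Literature.AlgebraicGeometry.Resolution

universe u

open Scheme.IdealSheafData

/-- **Cossart–Jannsen–Saito Thm. 1.4 (`B = ∅`) ⇒ resolution of embedded integral surfaces of codimension `≥ 2`.**
From `CossartJannsenSaito2020Embedded`: if `i : X ↪ Z` is a closed immersion of an integral scheme of dimension
`≤ 2` into a Noetherian regular excellent scheme and the local ring of `Z` at the generic point of `X` has
dimension `≥ 2`, then `X` admits a resolution of singularities.  The embedded datum `(Z₁, π, X₁, B₁)` of the fact
has `X₁ ≠ ∅` (see the module docstring: otherwise the normal crossings divisor `B₁ = π⁻¹(i(X))` would contain a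
proper generalization of the unique point over `i(η_X)`), and a non-degenerate datum gives a resolution by
`hasResolution_of_embeddedTransform_of_isRegular` (BGMW (3)⇒(4)).
[cite: CossartJannsenSaito2020, Thm. 1.4 (pp. 5–6) and p. 7 (proof of Cor. 1.5)]
[cite: BierstoneGrigorievMilmanWlodarczyk2011, §3.3 (3)⇒(4)] -/
theorem CossartJannsenSaito2020Embedded.hasResolution_of_two_le_ringKrullDim
    (h : CossartJannsenSaito2020Embedded.{u}) {X Z : Scheme.{u}} (i : X ⟶ Z) [IsClosedImmersion i]
    [IsIntegral X] [IsNoetherian Z] (hreg : Scheme.IsRegular Z) (hexc : Scheme.IsExcellent Z)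
    (hdim : topologicalKrullDim X ≤ 2)
    (h2 : (2 : WithBot ℕ∞) ≤ ringKrullDim (Z.presheaf.stalk (i (genericPoint X)))) :
    Scheme.HasResolution X := by
  obtain ⟨Z₁, π, X₁, B₁, hT, -, -, hsurj, ⟨U, hU, hiso⟩, hX₁, hB₁, htot, -⟩ := h X Z i hreg hexc hdim
  by_cases hne : X₁.Nonempty
  · exact hasResolution_of_embeddedTransform_of_isRegular i hT hne hX₁
  exfalso
  rw [Set.not_nonempty_iff_eq_empty] at hne
  set ξ : Z := i (genericPoint X) with hξdef
  -- `ξ ∈ U`: the generic point of `X` is a regular point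
  have hξU : ξ ∈ U := by
    apply hU
    rintro ⟨x', hx', hx'ξ⟩
    apply hx'
    rw [i.isClosedEmbedding.injective hx'ξ]
    change IsRegularLocalRing X.functionField
    infer_instance
  -- a point `ξ₁` over `ξ`; it lies in `B₁ = π⁻¹(i(X))`
  obtain ⟨ξ₁, hξ₁⟩ := hsurj ξ
  have hpre : π ⁻¹' Set.range i = B₁ := by rw [htot, hne, Set.empty_union]
  have hξ₁B : ξ₁ ∈ B₁ := by
    rw [← hpre]
    exact ⟨genericPoint X, hξ₁.symm⟩
  -- `dim 𝒪_{Z₁,ξ₁} = dim 𝒪_{Z,ξ} ≥ 2`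
  haveI := hiso
  have hξ₁U : π ξ₁ ∈ U := by rw [hξ₁]; exact hξU
  haveI := isIso_stalkMap_of_isIso_morphismRestrict π U ξ₁ hξ₁U
  have e : Z.presheaf.stalk (π ξ₁) ≃+* Z₁.presheaf.stalk ξ₁ :=
    (asIso (π.stalkMap ξ₁)).commRingCatIsoToRingEquiv
  have h2' : (2 : WithBot ℕ∞) ≤ ringKrullDim (Z₁.presheaf.stalk ξ₁) := by
    rw [← ringKrullDim_eq_of_ringEquiv e, hξ₁]
    exact h2
  -- a proper generalization `η` of `ξ₁` inside `B₁`
  obtain ⟨η, hηB, hηξ₁, hηne⟩ := hB₁.exists_specializes_ne_of_two_le_ringKrullDim hξ₁B h2'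
  -- `π η = ξ`: it generalizes `ξ` and lies in `i(X) = closure {ξ}`
  have hπη : π η = ξ := by
    have h1 : π η ⤳ ξ := hξ₁ ▸ hηξ₁.map π.continuous
    have hηX : π η ∈ Set.range i := by
      have : η ∈ π ⁻¹' Set.range i := by rw [hpre]; exact hηB
      exact this
    obtain ⟨x', hx'⟩ := hηX
    have h3 : ξ ⤳ π η := by
      rw [← hx']
      exact ((genericPoint_spec X).specializes (Set.mem_univ x')).map i.continuous
    exact (h1.antisymm h3).eq
  -- uniqueness of the point over `ξ ∈ U`
  obtain ⟨z, -, huniq⟩ := existsUnique_preimage_of_isIso_morphismRestrict π hiso hξU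
  exact hηne ((huniq η hπη).trans (huniq ξ₁ hξ₁).symm)

end Literature.AlgebraicGeometry.Resolution

end
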